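import Summits.NavierStokesRegularity.NavierStokesRegularity.Theorems.FluidComputerOneShot
import Literature.Analysis.FluidPDE.FluidComputer.CircuitArchitecture
import HarnessLib

/-!
# Fluid computer, ARCHITECTURE layer: what a shadowed circuit design gives for the true equations

HONEST FRAMING (verbatim, blueprint-wide): low prior, high value-of-information experiment on Tao's
machine paradigm; NOT a claim that NS blows up. No `ShadowedCircuit` is known to exist; every
theorem below is an implication from such a (so far uninhabited) structure.

`Literature.Analysis.FluidPDE.FluidComputer.ShadowedCircuit S O s` (bp3 gen 5) types Tao's
"abstract computer" [Tao2016AveragedNS, §1.3 pp. 10–11; (1.11)] over the TRUE Navier–Stokes mild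
dynamics (`IsMildSolutionFor eulerForm`, `ν = 1`): a finite-dimensional READOUT `read n : L2C → O`
with reconstruction `recon n` and abstract JUNK functional `junk n` (scale-`λ_n` units `√E_n`),
REGIONS `Acore ⊆ Ain`, `Aout` of the design space `O`, a CLOCKED CIRCUIT `Φ : ℝ → O → O` whose orbits
from `Ain` hit `Aout` with margin `δsh` within `τc` design ticks (`dat`), STATIC certificates
(`handoff`: `Aout` at generation `n` is `Acore` at generation `n+1`; `floor_cert`: `Ain` carries the
high-frequency energy floor `E_n`), the CLOCK inequality `unit n · τc ≤ Tmax n`, and the two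
IDEA-BOUND dynamical axioms `shadow` (the readout of every mild NS trajectory through `In n`
`δsh`-shadows the circuit for one tick) and `leak` (junk stays below `jrun √E_n` for one tick).

This file records, at summit level, what such a design buys — all by composition with the landed
cascade theorems (`FluidComputerCascade`, `FluidComputerRobust`, `FluidComputerOneShot`):

* `ns_blowup_of_shadowedCircuit` — Clay (A) fails (`α > 0`, `η > 1/4`), via `A.toPumpCascade`;
* `stableBlowup_of_shadowedCircuit` — an explicit BALL of blow-up data of `X^s_{λ₀}`-radius
  `ρ √E₀`, `ρ = min (δ/Λ) (jin - jcore) > 0` computed from the design margins (`0 ≤ s`), via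
  `A.toRobustPumpCascade`;
* `live_of_shadowedCircuit` — given the static `H¹⁰`-control hypothesis `A.H10Control`, the design's
  pump cascade is LIVE unconditionally (`h10MildTheory_holds` discharges the mild theory), hence
  no design state is doomed within a tick, every generation is LOADED along a chain of mild segments,
  and (`energy_reaches_all_scales_of_shadowedCircuit`) along the seed's maximal `H¹⁰_df`-mild
  trajectory the spec's energy `E_n` is present at frequency `≥ λ_n` at clocked instants
  `t_n ≤ ∑_{k<n} Tmax k < S_m ≤ T_*`, for EVERY `n` — the cascade theorem of the blueprint, now an
  implication from finitely many design-level certificates plus two context-free dynamical axioms;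
* `readout_shadows_circuit` — along that trajectory the finite-dimensional readout follows the
  designed circuit to within `δsh` during every generation's tick (the "computation is visible").

Nothing here lowers the burden: `shadow` ∧ `leak` for the true equations is exactly Tao's open
programme, and `H10Control` is PLAUSIBLE only for a junk functional controlling the full `X^{10}`
norm (ASSEMBLY.md §2g, "junk dial").
-/

open Set Filter Topology
open scoped SchwartzMap ENNReal BigOperators

namespace Summit.NavierStokesRegularity.NavierStokesRegularity.Theorems.FluidComputer

open Literature.Analysis.FluidPDE Literature.Analysis.FluidPDE.Tao2016
open Literature.Analysis.FluidPDE.FluidComputer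
open Literature.Analysis.FunctionSpaces (eFourierSobolevNorm)

variable {S : CascadeSpecs} {O : Type*} [PseudoMetricSpace O] {s : ℝ}

/-- **A shadowed circuit design for the true Navier–Stokes equations refutes Clay (A)** (`α > 0`,
`η > 1/4`) — through its pump cascade `A.toPumpCascade`. HONEST FRAMING: an implication from an
uninhabited-as-far-as-known structure; NOT a claim that NS blows up. -/
theorem ns_blowup_of_shadowedCircuit (A : ShadowedCircuit S O s) (hα : 0 < S.alpha)
    (hη : 1 / 4 < S.eta) : ¬ NavierStokesRegularity :=
  ns_blowup_of_pumpCascade A.toPumpCascade hα hη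

/-- **Stable blow-up from a design, with the radius computed from the design margins**: for
`0 ≤ s`, every divergence-free Schwartz datum within `X^s_{λ₀}`-distance `ρ √E₀` of the seed,
`ρ = min (δ/Λ) (jin - jcore)`, has all its `H¹⁰_df`-mild Navier–Stokes trajectories of lifespan
`≤ T_* = ∑ C λ_n^{-α}`. -/
theorem stableBlowup_of_shadowedCircuit (A : ShadowedCircuit S O s) (hs : 0 ≤ s)
    (hα : 0 < S.alpha) (hη : 1 / 4 < S.eta)
    (w₀ : 𝓢(EuclideanSpace ℝ (Fin 3), EuclideanSpace ℝ (Fin 3)))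
    (hdiv : VectorCalculus.IsDivFree ⇑w₀)
    (hnear : scaledSobolevNorm s (S.lam 0) (schwartzL2 w₀ - schwartzL2 A.u₀) <
      ENNReal.ofReal (A.rho * Real.sqrt (S.Emin 0)))
    {S' : ℝ} {u : ℝ → L2C} (hu : IsMildSolutionFor eulerForm (schwartzL2 w₀) (Ico 0 S') u) :
    S' ≤ S.Tstar :=
  stableBlowup_of_robustPumpCascade (A.toRobustPumpCascade hs) hα hη w₀ hdiv hnear hu

/-- **Stable blow-up on an `H¹⁰`-ball around the seed of a design** (`0 ≤ s ≤ 10`, `λ₀ ≥ 1`). -/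
theorem stableBlowup_H10ball_of_shadowedCircuit (A : ShadowedCircuit S O s) (hs0 : 0 ≤ s)
    (hs10 : s ≤ 10) (hlam : 1 ≤ S.lam0) (hα : 0 < S.alpha) (hη : 1 / 4 < S.eta)
    (w₀ : 𝓢(EuclideanSpace ℝ (Fin 3), EuclideanSpace ℝ (Fin 3)))
    (hdiv : VectorCalculus.IsDivFree ⇑w₀)
    (hnear : eFourierSobolevNorm 10 (schwartzL2 w₀ - schwartzL2 A.u₀) <
      ENNReal.ofReal (A.rho * Real.sqrt (S.Emin 0)))
    {S' : ℝ} {u : ℝ → L2C} (hu : IsMildSolutionFor eulerForm (schwartzL2 w₀) (Ico 0 S') u) :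
    S' ≤ S.Tstar :=
  stableBlowup_H10ball (A.toRobustPumpCascade hs0) hs0 hs10 hlam hα hη w₀ hdiv hnear hu

/-- **No unstable blow-up profile is a design**: if `H¹⁰_df`-mild lifespans are NOT locally bounded
by `T_*` near the seed in `X^s_{λ₀}` at ANY positive radius (in particular at the design's own margin
radius `ρ`), there is no shadowed circuit with that seed — the contrapositive of
`stableBlowup_of_shadowedCircuit`, i.e. the blueprint's robustness requirement is built into the type. -/
theorem no_shadowedCircuit_of_unstable (A : ShadowedCircuit S O s) (hs : 0 ≤ s) (hα : 0 < S.alpha)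
    (hη : 1 / 4 < S.eta)
    (hunst : ∀ ρ : ℝ, 0 < ρ → ∃ w₀ : 𝓢(EuclideanSpace ℝ (Fin 3), EuclideanSpace ℝ (Fin 3)),
      VectorCalculus.IsDivFree ⇑w₀ ∧
      scaledSobolevNorm s (S.lam 0) (schwartzL2 w₀ - schwartzL2 A.u₀) <
        ENNReal.ofReal (ρ * Real.sqrt (S.Emin 0)) ∧
      ∃ S' : ℝ, ∃ u : ℝ → L2C, IsMildSolutionFor eulerForm (schwartzL2 w₀) (Ico 0 S') u ∧
        S.Tstar < S') : False := by
  obtain ⟨w₀, hdiv, hnear, S', u, hu, hlt⟩ := hunst A.rho A.rho_pos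
  exact (not_le.mpr hlt) (stableBlowup_of_shadowedCircuit A hs hα hη w₀ hdiv hnear hu)

/-! ### Liveness and the cascade theorem, unconditionally in the mild theory -/

/-- **A design with static `H¹⁰` control is live**: `H10MildTheory` is a theorem for the true
equations (`h10MildTheory_holds`), so only the design-level hypothesis `A.H10Control` remains. -/
theorem live_of_shadowedCircuit (A : ShadowedCircuit S O s) (hctrl : A.H10Control) :
    A.toPumpCascade.Live :=
  A.live h10MildTheory_holds hctrl

/-- No design state (`read n v ∈ Ain`, `junk n v ≤ jin √E_n`) of class `H¹⁰_df` is doomed within the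
generation-`n` tick `unit n · τc`. -/
theorem not_doomed_of_shadowedCircuit (A : ShadowedCircuit S O s) (hctrl : A.H10Control) (n : ℕ)
    {v : L2C} (hv : v ∈ A.In n) (h10 : MemH10df v) : ¬ Doomed (A.unit n * A.τc) v :=
  A.not_doomed_of_mem_In h10MildTheory_holds hctrl n hv h10

/-- Every generation of a controlled design is LOADED: reached from the seed through mild segments by
an `H¹⁰_df` state in `In n` carrying high-frequency energy `≥ E_n` at frequency `≥ λ_n`. -/
theorem exists_loaded_of_shadowedCircuit (A : ShadowedCircuit S O s) (hctrl : A.H10Control)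
    (n : ℕ) : ∃ v ∈ A.In n, MemH10df v ∧ ENNReal.ofReal (S.Emin n) ≤ highFreqEnergy (S.lam n) v :=
  A.exists_loaded h10MildTheory_holds hctrl n

/-- **All generations fire along the seed's maximal trajectory** (controlled design, `α > 0`,
`η > 1/4`): the seed's maximal `H¹⁰_df`-mild Navier–Stokes solution `U` on `[0, S_m)`, `S_m ≤ T_*`,
has unbounded `H¹⁰` norm and passes through the design classes `In n` at clocked instants
`0 = t₀ ≤ t₁ ≤ …`, `t_{n+1} - t_n ≤ unit n · τc`, `t_n < S_m`, for every `n`. -/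
theorem allGenerationsFire_of_shadowedCircuit (A : ShadowedCircuit S O s) (hα : 0 < S.alpha)
    (hη : 1 / 4 < S.eta) (hctrl : A.H10Control) :
    ∃ Sm : ℝ, 0 < Sm ∧ Sm ≤ S.Tstar ∧ ∃ U : ℝ → L2C,
      IsMildSolutionFor eulerForm (schwartzL2 A.u₀) (Ico 0 Sm) U ∧
      (¬ ∃ S' : ℝ, Sm < S' ∧ ∃ v : ℝ → L2C,
        IsMildSolutionFor eulerForm (schwartzL2 A.u₀) (Ico 0 S') v ∧ ∀ s ∈ Ico 0 Sm, v s = U s) ∧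
      (∀ C : ℝ, ∃ s ∈ Ico 0 Sm, ENNReal.ofReal C < eFourierSobolevNorm 10 (U s)) ∧
      ∃ t : ℕ → ℝ, t 0 = 0 ∧ Monotone t ∧ (∀ n, t n < Sm) ∧
        (∀ n, t (n + 1) - t n ≤ A.unit n * A.τc) ∧ ∀ n, U (t n) ∈ A.In n :=
  allGenerationsFire A.toPumpCascade hα hη (live_of_shadowedCircuit A hctrl)

/-- **THE CASCADE THEOREM for a controlled design** (`α > 0`, `η > 1/4`): along the seed's maximal
`H¹⁰_df`-mild Navier–Stokes trajectory, for EVERY generation `n` the spec's energy `E_n` is present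
at frequency `≥ λ_n = 2ⁿ λ₀` at a clocked instant `t_n ≤ ∑_{k<n} Tmax k`, `t_n < S_m ≤ T_*`; and the
`H¹⁰` norm is unbounded on `[0, S_m)`. Energy actually reaches arbitrarily fine scales in finite
time — as an implication from the design's finitely many certificates and its two dynamical axioms. -/
theorem energy_reaches_all_scales_of_shadowedCircuit (A : ShadowedCircuit S O s)
    (hα : 0 < S.alpha) (hη : 1 / 4 < S.eta) (hctrl : A.H10Control) :
    ∃ Sm : ℝ, 0 < Sm ∧ Sm ≤ S.Tstar ∧ ∃ U : ℝ → L2C,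
      IsMildSolutionFor eulerForm (schwartzL2 A.u₀) (Ico 0 Sm) U ∧
      (∀ C : ℝ, ∃ s ∈ Ico 0 Sm, ENNReal.ofReal C < eFourierSobolevNorm 10 (U s)) ∧
      ∃ t : ℕ → ℝ, t 0 = 0 ∧ Monotone t ∧
        ∀ n, t n < Sm ∧ t n ≤ ∑ k ∈ Finset.range n, S.Tmax k ∧
          ENNReal.ofReal (S.Emin n) ≤ highFreqEnergy (S.lam n) (U (t n)) :=
  energy_reaches_all_scales A.toPumpCascade hα hη (live_of_shadowedCircuit A hctrl)

/-- **The computation is visible along the blow-up trajectory**: with `U`, `S_m`, `t` as in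
`allGenerationsFire_of_shadowedCircuit`, during every generation's tick the finite-dimensional
readout of the true solution follows the designed circuit orbit from the gate-entry readout to within
the shadowing margin `δsh`, for as long as the trajectory lives (`shadow` applied at `t_n`). -/
theorem readout_shadows_circuit (A : ShadowedCircuit S O s) (hα : 0 < S.alpha)
    (hη : 1 / 4 < S.eta) (hctrl : A.H10Control) :
    ∃ Sm : ℝ, 0 < Sm ∧ Sm ≤ S.Tstar ∧ ∃ U : ℝ → L2C,
      IsMildSolutionFor eulerForm (schwartzL2 A.u₀) (Ico 0 Sm) U ∧
      ∃ t : ℕ → ℝ, t 0 = 0 ∧ Monotone t ∧ (∀ n, t n < Sm) ∧ (∀ n, U (t n) ∈ A.In n) ∧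
        ∀ n σ, 0 ≤ σ → σ ≤ A.τc → t n + A.unit n * σ < Sm →
          dist (A.read n (U (t n + A.unit n * σ))) (A.Φ σ (A.read n (U (t n)))) ≤ A.δsh ∧
          A.junk n (U (t n + A.unit n * σ)) ≤ ENNReal.ofReal (A.jrun * Real.sqrt (S.Emin n)) := by
  obtain ⟨Sm, hSm, hle, U, hU, -, -, t, ht0, htmono, htlt, -, hmem⟩ :=
    allGenerationsFire_of_shadowedCircuit A hα hη hctrl
  have ht_nonneg : ∀ n, 0 ≤ t n := fun n => ht0 ▸ htmono (Nat.zero_le n)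
  refine ⟨Sm, hSm, hle, U, hU, t, ht0, htmono, htlt, hmem, fun n σ hσ0 hστ hlt => ?_⟩
  exact ⟨A.shadow n _ Sm U hU (t n) (ht_nonneg n) (hmem n).1 (hmem n).2 σ hσ0 hστ hlt,
    A.leak n _ Sm U hU (t n) (ht_nonneg n) (hmem n).1 (hmem n).2 σ hσ0 hστ hlt⟩


end Summit.NavierStokesRegularity.NavierStokesRegularity.Theorems.FluidComputer
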